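import Literature.Analysis.FluidPDE.AxisymNoSwirlLocalMaxPrinciple
import Literature.Analysis.FluidPDE.AxisymRadialQuotient
import HarnessLib

/-!
# SwirlFreeBudget, crux K-18.1 `EtaMoserBound`, step A.1: the classical equation
# `∂ₜη + b·∇η = Δη + (2/r)∂ᵣη` of `η = ω_θ/r` in three dimensions (seat nsreg-p4 g13)

Support file for the DORMANT route `SwirlThreshold` (crux stmt-NavierStokesRegularity-2002) and
planner nsreg-p2's ROUND-18 Appendix A (`R18-APPENDIX-EtaMoser.md`, §A.1).  The reverse Hölder
step for `η` (the hypothesis of the tree theorem `etaMoserBound_of_etaReverseHolder`) is an energy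
estimate for the scalar equation (A.1) `∂ₜη + b·∇η = Δη + (2/r)∂ᵣη` (KNSS 2009, (5.10)).  The tree
has this equation LIFTED to `ℝ⁵` (`Literature.Analysis.FluidPDE.noSwirlLift_integral_eq'`,
`…noSwirlLift_hasDerivAt`, for the maximum principle); the energy method in `r dr dθ dz` needs it in
`ℝ³`, with the axis term `(2/r)∂ᵣη = 2 · radDerivQuot η` (the smooth radial derivative quotient of
`Literature.Analysis.FluidPDE.radDerivQuot`).  Setting (the tree's, verbatim): `W : ℝ → ℝ³ → ℝ³`
has, for `τ ∈ I` (`I` an interval), `C^∞` axisymmetric swirl-free slices on all of `ℝ³` whose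
`x`-derivatives of every order are continuous in `τ` uniformly in `x`, and the classical
time-integrated vorticity equation holds at the points of `B(c, R₁)` with an integrand continuous
in time (in the application `W = χ • V` is the cut-off Seregin–Zajączkowski representative,
`…Theorems.AxisymmetricKatoGlobal.EulerScaling.cutoffField_vorticity_package`); `f τ =
hadamardQuotFst ((curl W τ) ·)₁ = ω_θ/r`.

* `laplacian_eq_sum_fderiv_fderiv_single` — `Δ f (x) = Σᵢ ∂ᵢ∂ᵢ f (x)` in the standard basis;
* `eqOn_of_eqOn_off_plane` — continuous functions on an open set of `ℝ³` agreeing off the plane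
  `{x₀ = 0}` agree;
* `eta_integrand_continuousOn` — joint continuity on `I × ℝ³` of
  `L(τ, x) = Δf − Df[W] + 2 radDerivQuot f`;
* `eta_integral_eq` — **(A.1), integrated**: for `x ∈ B(c, R₁)`, `s ≤ t` in `I`,
  `f(t,x) − f(s,x) = ∫ₛᵗ L(τ,x) dτ` (from the `θ`-component of the vorticity equation,
  `integral_scalarEq_of_vorticityEq`: `r²(f(t)−f(s)) = ∫(r²(Δf − Df[W]) + 2(x₀∂₀f + x₁∂₁f))`, the
  identity `x₀∂₀f + x₁∂₁f = r² radDerivQuot f` of an axisymmetric scalar, and removal of the weight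
  `r²` across the axis by continuity);
* `eta_hasDerivAt` — **(A.1), classical**: `∂ₜ f(·, x) = L(t, x)` at every `t ∈ I` (`I` open).

WHAT THIS IS NOT: not NS regularity — calculus for the smooth swirl-free class; `EtaMoserBound`
stays OPEN here; no crux claim.
-/

-- the problem directory repeats the summit name (D-0017); core's `dupNamespace` linter fires
set_option linter.dupNamespace false

namespace Summit.NavierStokesRegularity.NavierStokesRegularity.Theorems.SwirlFreeBudget

open MeasureTheory Set Filter Topology Metric Function
open scoped RealInnerProductSpace Laplacian ContDiff
open Literature.Analysis Literature.Analysis.FluidPDE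

noncomputable section

/-! ### Two pieces of calculus -/

/-- `Δ f (x) = Σᵢ ∂ᵢ(∂ᵢ f)(x)` in the standard basis of `ℝ³`, for `f ∈ C²`. -/
theorem laplacian_eq_sum_fderiv_fderiv_single {f : EuclideanSpace ℝ (Fin 3) → ℝ}
    (hf : ContDiff ℝ 2 f) (x : EuclideanSpace ℝ (Fin 3)) :
    (Δ f) x = ∑ i : Fin 3, fderiv ℝ (fun y => fderiv ℝ f y (EuclideanSpace.single i 1)) x
      (EuclideanSpace.single i 1) := by
  rw [InnerProductSpace.laplacian_eq_iteratedFDeriv_orthonormalBasis f (EuclideanSpace.basisFun (Fin 3) ℝ)]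
  refine Finset.sum_congr rfl fun i _ => ?_
  have hd : DifferentiableAt ℝ (fderiv ℝ f) x :=
    ((hf.fderiv_right (m := 1) le_rfl).differentiable one_ne_zero) x
  rw [iteratedFDeriv_two_apply, EuclideanSpace.basisFun_apply,
    fderiv_clm_apply hd (differentiableAt_const _)]
  simp

/-- Two functions continuous on an open `U ⊆ ℝ³` which agree at the points of `U` off the plane
`{x₀ = 0}` agree on `U` (approach a point of the plane along `x + ε e₀`). -/
theorem eqOn_of_eqOn_off_plane {X : Type*} [TopologicalSpace X] [T2Space X]
    {U : Set (EuclideanSpace ℝ (Fin 3))} (hU : IsOpen U) {g₁ g₂ : EuclideanSpace ℝ (Fin 3) → X}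
    (h₁ : ContinuousOn g₁ U) (h₂ : ContinuousOn g₂ U)
    (h : ∀ z ∈ U, z 0 ≠ 0 → g₁ z = g₂ z) : EqOn g₁ g₂ U := by
  intro z hz
  by_cases hPz : z 0 ≠ 0
  · exact h z hz hPz
  push Not at hPz
  set v : EuclideanSpace ℝ (Fin 3) := EuclideanSpace.single 0 1 with hv
  set γ : ℝ → EuclideanSpace ℝ (Fin 3) := fun ε => z + ε • v with hγ
  have hγc : Continuous γ := by fun_prop
  have hγ0 : γ 0 = z := by simp [hγ]
  have hγU : ∀ᶠ ε in 𝓝 (0 : ℝ), γ ε ∈ U := by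
    have : Tendsto γ (𝓝 0) (𝓝 z) := by rw [← hγ0]; exact hγc.tendsto 0
    exact this (hU.mem_nhds hz)
  have hγoff : ∀ᶠ ε in 𝓝[≠] (0 : ℝ), γ ε 0 ≠ 0 := by
    refine eventually_nhdsWithin_of_forall fun ε hε => ?_
    simpa [hγ, hv, hPz] using hε
  have heq : ∀ᶠ ε in 𝓝[≠] (0 : ℝ), g₁ (γ ε) = g₂ (γ ε) := by
    filter_upwards [hγoff, nhdsWithin_le_nhds hγU] with ε hoff hmem
    exact h _ hmem hoff
  have hT : Tendsto γ (𝓝[≠] 0) (𝓝[U] z) := by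
    refine tendsto_nhdsWithin_iff.2 ⟨?_, nhdsWithin_le_nhds hγU⟩
    rw [← hγ0]
    exact (hγc.tendsto 0).mono_left nhdsWithin_le_nhds
  have hl₁ : Tendsto (fun ε => g₁ (γ ε)) (𝓝[≠] 0) (𝓝 (g₁ z)) := (h₁ z hz).tendsto.comp hT
  have hl₂ : Tendsto (fun ε => g₂ (γ ε)) (𝓝[≠] 0) (𝓝 (g₂ z)) := (h₂ z hz).tendsto.comp hT
  haveI : (𝓝[≠] (0 : ℝ)).NeBot := inferInstance
  exact tendsto_nhds_unique (hl₁.congr' heq) hl₂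

/-! ### The equation for `f = ω_θ/r` in `ℝ³` -/

section Equation

variable {W : ℝ → EuclideanSpace ℝ (Fin 3) → EuclideanSpace ℝ (Fin 3)} {I : Set ℝ}
  {c : EuclideanSpace ℝ (Fin 3)} {R₁ : ℝ}

/-- **Joint continuity on `I × ℝ³` of the right-hand side `L = Δf − Df[W] + 2 radDerivQuot f`**
of the equation for `f τ = hadamardQuotFst ((curl W τ) ·)₁` (from the uniform-in-`x` time moduli:
the tree's `scalar_family_continuousOn`, `family_continuousOn`; `radDerivQuot f =
hadamardQuotFst (∂₀ f)` by definition and `Δ f = Σᵢ ∂ᵢ∂ᵢ f`). -/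
theorem eta_integrand_continuousOn (hsmooth : ∀ τ ∈ I, ContDiff ℝ ∞ (W τ))
    (hunif : ∀ k : ℕ, ∀ τ ∈ I, ∀ ε > 0, ∃ δ > 0, ∀ τ' ∈ I, |τ' - τ| < δ → ∀ y,
      ‖iteratedFDeriv ℝ k (W τ') y - iteratedFDeriv ℝ k (W τ) y‖ ≤ ε)
    {f : ℝ → EuclideanSpace ℝ (Fin 3) → ℝ} (hfW : ∀ τ, f τ = hadamardQuotFst fun z => curl (W τ) z 1) :
    ContinuousOn (fun p : ℝ × EuclideanSpace ℝ (Fin 3) =>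
      (Δ (f p.1)) p.2 - fderiv ℝ (f p.1) p.2 (W p.1 p.2) + 2 * radDerivQuot (f p.1) p.2) (I ×ˢ univ) := by
  obtain ⟨hf', -, hDc', hiic', hqc'⟩ := scalar_family_continuousOn hsmooth hunif
  have hfun : (fun τ => hadamardQuotFst fun z => curl (W τ) z 1) = f := funext fun τ => (hfW τ).symm
  have hf : ∀ τ ∈ I, ContDiff ℝ ∞ (f τ) := by simpa only [← hfun] using hf'
  have hDc : ContinuousOn (fun p : ℝ × EuclideanSpace ℝ (Fin 3) => fderiv ℝ (f p.1) p.2) (I ×ˢ univ) := by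
    simpa only [← hfun] using hDc'
  have hiic : ∀ i : Fin 3, ContinuousOn (fun p : ℝ × EuclideanSpace ℝ (Fin 3) =>
      fderiv ℝ (fun z => fderiv ℝ (f p.1) z (EuclideanSpace.single i 1)) p.2 (EuclideanSpace.single i 1))
      (I ×ˢ univ) := fun i => by
    simpa only [← hfun] using hiic' i
  have hqc : ContinuousOn (fun p : ℝ × EuclideanSpace ℝ (Fin 3) =>
      hadamardQuotFst (fun z => fderiv ℝ (f p.1) z (EuclideanSpace.single 0 1)) p.2) (I ×ˢ univ) := by
    simpa only [← hfun] using hqc'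
  have hWc := family_continuousOn hsmooth hunif
  have hD : ContinuousOn (fun p : ℝ × EuclideanSpace ℝ (Fin 3) => fderiv ℝ (f p.1) p.2 (W p.1 p.2))
      (I ×ˢ univ) := hDc.clm_apply hWc
  have hΔ : ContinuousOn (fun p : ℝ × EuclideanSpace ℝ (Fin 3) => (Δ (f p.1)) p.2) (I ×ˢ univ) := by
    have hsum : ContinuousOn (fun p : ℝ × EuclideanSpace ℝ (Fin 3) => ∑ i : Fin 3,
        fderiv ℝ (fun z => fderiv ℝ (f p.1) z (EuclideanSpace.single i 1)) p.2 (EuclideanSpace.single i 1))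
        (I ×ˢ univ) := continuousOn_finsetSum _ fun i _ => hiic i
    refine hsum.congr fun p hp => ?_
    exact laplacian_eq_sum_fderiv_fderiv_single ((hf p.1 hp.1).of_le (by norm_cast)) p.2
  exact (hΔ.sub hD).add ((continuousOn_const (c := (2 : ℝ))).mul hqc)

/-- **The equation for `η = ω_θ/r` in `ℝ³`, local integrated form** (KNSS 2009, (5.10), p. 9:
"nothing but the `θ`-component of the equation for `ω`"; memo A.1, display (A.1)).  Under the
standing hypotheses (module docstring), for every `x ∈ B(c, R₁)` and `s ≤ t` in `I`,
`f(t, x) − f(s, x) = ∫ₛᵗ (Δf − Df[W] + 2 radDerivQuot f)(τ, x) dτ`.  Proof: at every point of the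
ball the tree's `integral_scalarEq_of_vorticityEq` gives this identity multiplied by `r² = x₀² + x₁²`,
once `x₀∂₀f + x₁∂₁f = r² radDerivQuot f` (`mul_radDerivQuot_eq_fderiv_zero/one`) is used; both
sides are continuous in `x` on the ball, and the plane `{x₀ = 0} ⊇ {r = 0}` has empty interior. -/
theorem eta_integral_eq (hIc : I.OrdConnected)
    (hsmooth : ∀ τ ∈ I, ContDiff ℝ ∞ (W τ))
    (hunif : ∀ k : ℕ, ∀ τ ∈ I, ∀ ε > 0, ∃ δ > 0, ∀ τ' ∈ I, |τ' - τ| < δ → ∀ y,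
      ‖iteratedFDeriv ℝ k (W τ') y - iteratedFDeriv ℝ k (W τ) y‖ ≤ ε)
    (hax : ∀ τ ∈ I, IsAxisymmetric (W τ)) (hsw : ∀ τ ∈ I, HasNoSwirl (W τ))
    (hvort : ∀ x ∈ ball c R₁, ∀ s ∈ I, ∀ t ∈ I, s ≤ t →
      curl (W t) x - curl (W s) x =
        ∫ τ in s..t, ((Δ (curl (W τ))) x - fderiv ℝ (curl (W τ)) x (W τ x) +
          fderiv ℝ (W τ) x (curl (W τ) x)))
    (hvortc : ∀ x ∈ ball c R₁, ContinuousOn (fun τ => (Δ (curl (W τ))) x -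
      fderiv ℝ (curl (W τ)) x (W τ x) + fderiv ℝ (W τ) x (curl (W τ) x)) I)
    {f : ℝ → EuclideanSpace ℝ (Fin 3) → ℝ} (hfW : ∀ τ, f τ = hadamardQuotFst fun z => curl (W τ) z 1)
    {x : EuclideanSpace ℝ (Fin 3)} (hx : x ∈ ball c R₁) {s t : ℝ} (hs : s ∈ I) (ht : t ∈ I)
    (hst : s ≤ t) :
    f t x - f s x =
      ∫ τ in s..t, ((Δ (f τ)) x - fderiv ℝ (f τ) x (W τ x) + 2 * radDerivQuot (f τ) x) := by
  -- ## regularity of the scalar family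
  have hstI : Icc s t ⊆ I := hIc.out hs ht
  have hsl := noSwirl_scalar_slices hsmooth hax hsw hfW
  have hf : ∀ τ ∈ I, ContDiff ℝ ∞ (f τ) := fun τ hτ => (hsl τ hτ).1
  have hfax : ∀ τ ∈ I, IsAxisymmetricScalar (f τ) := fun τ hτ => (hsl τ hτ).2.1
  have hf2 : ∀ τ ∈ I, ContDiff ℝ 2 (f τ) := fun τ hτ => (hf τ hτ).of_le (by norm_cast)
  have hstr := noSwirl_family_structure hsmooth hax hsw
  -- ## Step 1: the weighted identity at every point of the ball
  have hweighted : ∀ x' ∈ ball c R₁,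
      (x' 0 ^ 2 + x' 1 ^ 2) * ((f t x' - f s x') -
        ∫ τ in s..t, ((Δ (f τ)) x' - fderiv ℝ (f τ) x' (W τ x') + 2 * radDerivQuot (f τ) x')) = 0 := by
    intro x' hx'
    have hU4 : ∀ τ ∈ Icc s t, ContDiff ℝ 4 (W τ) := fun τ hτ =>
      (hsmooth τ (hstI hτ)).of_le (by norm_cast)
    have h2' : ∀ τ ∈ Icc s t, ∀ z : EuclideanSpace ℝ (Fin 3), curl (W τ) z 2 = 0 := fun τ hτ =>
      (hstr τ (hstI hτ)).1
    have hb' : ∀ τ ∈ Icc s t, ∀ z : EuclideanSpace ℝ (Fin 3),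
        z 0 * curl (W τ) z 0 + z 1 * curl (W τ) z 1 = 0 := fun τ hτ => (hstr τ (hstI hτ)).2.1
    have hax' : ∀ᵐ τ ∂(volume : Measure ℝ), τ ∈ Ioo s t →
        fderiv ℝ (W τ) x' (rotGen x') = rotGen (W τ x' + (0 : ℝ → EuclideanSpace ℝ (Fin 3)) τ) := by
      refine ae_of_all _ fun τ hτI => ?_
      have hτ : τ ∈ I := hstI (Ioo_subset_Icc_self hτI)
      have hd : DifferentiableAt ℝ (W τ) x' := ((hsmooth τ hτ).differentiable (by simp)) _
      rw [Pi.zero_apply, add_zero]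
      exact (hax τ hτ).fderiv_rotGen hd
    have hint : IntervalIntegrable (fun τ => (Δ (curl (W τ))) x' -
        fderiv ℝ (curl (W τ)) x' (W τ x' + (0 : ℝ → EuclideanSpace ℝ (Fin 3)) τ) +
          fderiv ℝ (W τ) x' (curl (W τ) x')) volume s t := by
      have hc' : ContinuousOn (fun τ => (Δ (curl (W τ))) x' -
          fderiv ℝ (curl (W τ)) x' (W τ x') + fderiv ℝ (W τ) x' (curl (W τ) x')) (uIcc s t) := by
        rw [uIcc_of_le hst]; exact (hvortc _ hx').mono hstI
      simpa only [Pi.zero_apply, add_zero] using hc'.intervalIntegrable (μ := volume)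
    have heq' : curl (W t) x' - curl (W s) x' =
        ∫ τ in s..t, ((Δ (curl (W τ))) x' -
          fderiv ℝ (curl (W τ)) x' (W τ x' + (0 : ℝ → EuclideanSpace ℝ (Fin 3)) τ) +
            fderiv ℝ (W τ) x' (curl (W τ) x')) := by
      simpa only [Pi.zero_apply, add_zero] using hvort _ hx' s hs t ht hst
    have hB2 := integral_scalarEq_of_vorticityEq hst hU4 h2' hb' hax' hint heq'
    simp only [← hfW] at hB2
    -- rewrite the integrand: `x₀∂₀f + x₁∂₁f = r² · radDerivQuot f`
    have hI' : ∀ τ ∈ uIcc s t,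
        (x' 0 ^ 2 + x' 1 ^ 2) * ((Δ (f τ)) x' -
            fderiv ℝ (f τ) x' (W τ x' + (0 : ℝ → EuclideanSpace ℝ (Fin 3)) τ)) +
          2 * (x' 0 * fderiv ℝ (f τ) x' (EuclideanSpace.single 0 1) +
            x' 1 * fderiv ℝ (f τ) x' (EuclideanSpace.single 1 1)) =
        (x' 0 ^ 2 + x' 1 ^ 2) *
          ((Δ (f τ)) x' - fderiv ℝ (f τ) x' (W τ x') + 2 * radDerivQuot (f τ) x') := by
      intro τ hτ
      rw [uIcc_of_le hst] at hτ
      have hτ0 : τ ∈ I := hstI hτ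
      rw [← mul_radDerivQuot_eq_fderiv_zero (hf2 τ hτ0) (hfax τ hτ0) x',
        ← mul_radDerivQuot_eq_fderiv_one (hf2 τ hτ0) (hfax τ hτ0) x', Pi.zero_apply, add_zero]
      ring
    rw [intervalIntegral.integral_congr hI', intervalIntegral.integral_const_mul] at hB2
    linear_combination hB2
  -- ## Step 2: continuity of both sides on the ball
  have hΦc := eta_integrand_continuousOn hsmooth hunif hfW
  obtain ⟨g, hg⟩ : ∃ g : EuclideanSpace ℝ (Fin 3) → ℝ → ℝ, ∀ x' τ, g x' τ =
      (Δ (f (projIcc s t hst τ))) x' - fderiv ℝ (f (projIcc s t hst τ)) x' (W (projIcc s t hst τ) x') +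
        2 * radDerivQuot (f (projIcc s t hst τ)) x' := ⟨_, fun _ _ => rfl⟩
  have hgc : Continuous (uncurry g) := by
    have hπ : Continuous fun q : EuclideanSpace ℝ (Fin 3) × ℝ => ((projIcc s t hst q.2 : ℝ), q.1) :=
      (continuous_subtype_val.comp (continuous_projIcc.comp continuous_snd)).prodMk continuous_fst
    have hπm : ∀ q : EuclideanSpace ℝ (Fin 3) × ℝ,
        ((projIcc s t hst q.2 : ℝ), q.1) ∈ I ×ˢ (univ : Set (EuclideanSpace ℝ (Fin 3))) := fun q =>
      ⟨hstI (projIcc s t hst q.2).2, mem_univ _⟩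
    have h := hΦc.comp_continuous hπ hπm
    refine h.congr fun q => ?_
    simp only [comp_apply, uncurry, hg]
  have hRc : Continuous fun x' : EuclideanSpace ℝ (Fin 3) => ∫ τ in s..t, g x' τ :=
    intervalIntegral.continuous_parametric_intervalIntegral_of_continuous' hgc s t
  have hR_eq : ∀ x' : EuclideanSpace ℝ (Fin 3),
      (∫ τ in s..t, ((Δ (f τ)) x' - fderiv ℝ (f τ) x' (W τ x') + 2 * radDerivQuot (f τ) x')) =
        ∫ τ in s..t, g x' τ := by
    intro x'
    refine intervalIntegral.integral_congr fun τ hτ => ?_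
    rw [uIcc_of_le hst] at hτ
    rw [hg, projIcc_of_mem hst hτ]
  have hLc : Continuous fun x' : EuclideanSpace ℝ (Fin 3) => f t x' - f s x' :=
    (hf t ht).continuous.sub (hf s hs).continuous
  -- ## conclusion across the plane `{x₀ = 0}`
  have key : EqOn (fun x' => f t x' - f s x')
      (fun x' => ∫ τ in s..t, ((Δ (f τ)) x' - fderiv ℝ (f τ) x' (W τ x') + 2 * radDerivQuot (f τ) x'))
      (ball c R₁) := by
    refine eqOn_of_eqOn_off_plane isOpen_ball hLc.continuousOn ?_ fun z hz hz0 => ?_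
    · exact (hRc.congr fun x' => (hR_eq x').symm).continuousOn
    · have hne : z 0 ^ 2 + z 1 ^ 2 ≠ 0 := by positivity
      exact sub_eq_zero.1 ((mul_eq_zero.1 (hweighted z hz)).resolve_left hne)
  exact key hx

/-- Continuity in time, at a fixed `x`, of the right-hand side `L(·, x)`. -/
theorem eta_integrand_continuousOn_time (hsmooth : ∀ τ ∈ I, ContDiff ℝ ∞ (W τ))
    (hunif : ∀ k : ℕ, ∀ τ ∈ I, ∀ ε > 0, ∃ δ > 0, ∀ τ' ∈ I, |τ' - τ| < δ → ∀ y,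
      ‖iteratedFDeriv ℝ k (W τ') y - iteratedFDeriv ℝ k (W τ) y‖ ≤ ε)
    {f : ℝ → EuclideanSpace ℝ (Fin 3) → ℝ} (hfW : ∀ τ, f τ = hadamardQuotFst fun z => curl (W τ) z 1)
    (x : EuclideanSpace ℝ (Fin 3)) :
    ContinuousOn (fun τ => (Δ (f τ)) x - fderiv ℝ (f τ) x (W τ x) + 2 * radDerivQuot (f τ) x) I := by
  have h := eta_integrand_continuousOn hsmooth hunif hfW
  have hm : MapsTo (fun τ : ℝ => ((τ, x) : ℝ × EuclideanSpace ℝ (Fin 3))) I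
      (I ×ˢ (univ : Set (EuclideanSpace ℝ (Fin 3)))) := fun τ hτ => ⟨hτ, mem_univ _⟩
  have h2 := ContinuousOn.comp (g := fun p : ℝ × EuclideanSpace ℝ (Fin 3) =>
      (Δ (f p.1)) p.2 - fderiv ℝ (f p.1) p.2 (W p.1 p.2) + 2 * radDerivQuot (f p.1) p.2)
    (f := fun τ : ℝ => ((τ, x) : ℝ × EuclideanSpace ℝ (Fin 3))) h
    (Continuous.prodMk_left x).continuousOn hm
  exact h2.congr fun τ _ => rfl

/-- **The equation for `η = ω_θ/r` in `ℝ³`, classical form `∂ₜf = Δf − Df[W] + 2 radDerivQuot f`**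
(KNSS 2009 (5.10); memo A.1 (A.1)): under the hypotheses of `eta_integral_eq` with `I` an OPEN
interval, for `x ∈ B(c, R₁)` the time line `τ ↦ f(τ, x)` is differentiable at every `t ∈ I` with
derivative `L(t, x)` (fundamental theorem of calculus on the integrated form). -/
theorem eta_hasDerivAt (hI : IsOpen I) (hIc : I.OrdConnected)
    (hsmooth : ∀ τ ∈ I, ContDiff ℝ ∞ (W τ))
    (hunif : ∀ k : ℕ, ∀ τ ∈ I, ∀ ε > 0, ∃ δ > 0, ∀ τ' ∈ I, |τ' - τ| < δ → ∀ y,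
      ‖iteratedFDeriv ℝ k (W τ') y - iteratedFDeriv ℝ k (W τ) y‖ ≤ ε)
    (hax : ∀ τ ∈ I, IsAxisymmetric (W τ)) (hsw : ∀ τ ∈ I, HasNoSwirl (W τ))
    (hvort : ∀ x ∈ ball c R₁, ∀ s ∈ I, ∀ t ∈ I, s ≤ t →
      curl (W t) x - curl (W s) x =
        ∫ τ in s..t, ((Δ (curl (W τ))) x - fderiv ℝ (curl (W τ)) x (W τ x) +
          fderiv ℝ (W τ) x (curl (W τ) x)))
    (hvortc : ∀ x ∈ ball c R₁, ContinuousOn (fun τ => (Δ (curl (W τ))) x -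
      fderiv ℝ (curl (W τ)) x (W τ x) + fderiv ℝ (W τ) x (curl (W τ) x)) I)
    {f : ℝ → EuclideanSpace ℝ (Fin 3) → ℝ} (hfW : ∀ τ, f τ = hadamardQuotFst fun z => curl (W τ) z 1)
    {x : EuclideanSpace ℝ (Fin 3)} (hx : x ∈ ball c R₁) {t : ℝ} (ht : t ∈ I) :
    HasDerivAt (fun τ => f τ x)
      ((Δ (f t)) x - fderiv ℝ (f t) x (W t x) + 2 * radDerivQuot (f t) x) t := by
  obtain ⟨ε, hε, hball⟩ := Metric.isOpen_iff.1 hI t ht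
  set s₀ : ℝ := t - ε / 2 with hs₀
  have hs₀I : s₀ ∈ I := hball (by
    rw [Metric.mem_ball, Real.dist_eq, hs₀, show t - ε / 2 - t = -(ε / 2) by ring, abs_neg,
      abs_of_pos (half_pos hε)]
    exact half_lt_self hε)
  have hs₀t : s₀ < t := by rw [hs₀]; linarith
  obtain ⟨Ψ, hΨ⟩ : ∃ Ψ : ℝ → ℝ, ∀ τ, Ψ τ =
      (Δ (f τ)) x - fderiv ℝ (f τ) x (W τ x) + 2 * radDerivQuot (f τ) x := ⟨_, fun _ => rfl⟩
  have hΨc : ContinuousOn Ψ I := by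
    have h := eta_integrand_continuousOn_time hsmooth hunif hfW x
    exact h.congr fun τ _ => hΨ τ
  have hrep : ∀ τ ∈ I, f τ x = f s₀ x + ∫ σ in s₀..τ, Ψ σ := by
    intro τ hτ
    rcases le_total s₀ τ with hle | hle
    · have h := eta_integral_eq hIc hsmooth hunif hax hsw hvort hvortc hfW hx hs₀I hτ hle
      rw [show (∫ σ in s₀..τ, Ψ σ) = ∫ σ in s₀..τ,
          ((Δ (f σ)) x - fderiv ℝ (f σ) x (W σ x) + 2 * radDerivQuot (f σ) x) from
        intervalIntegral.integral_congr fun σ _ => hΨ σ]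
      linarith
    · have h := eta_integral_eq hIc hsmooth hunif hax hsw hvort hvortc hfW hx hτ hs₀I hle
      rw [intervalIntegral.integral_symm,
        show (∫ σ in τ..s₀, Ψ σ) = ∫ σ in τ..s₀,
          ((Δ (f σ)) x - fderiv ℝ (f σ) x (W σ x) + 2 * radDerivQuot (f σ) x) from
        intervalIntegral.integral_congr fun σ _ => hΨ σ]
      linarith
  have hIn : I ∈ 𝓝 t := hI.mem_nhds ht
  have hcont : ContinuousAt Ψ t := hΨc.continuousAt hIn
  have hmeas : StronglyMeasurableAtFilter Ψ (𝓝 t) volume :=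
    hΨc.stronglyMeasurableAtFilter hI _ ht
  have hii : IntervalIntegrable Ψ volume s₀ t := by
    refine (hΨc.mono ?_).intervalIntegrable
    rw [uIcc_of_le hs₀t.le]; exact hIc.out hs₀I ht
  have hprim : HasDerivAt (fun τ => f s₀ x + ∫ σ in s₀..τ, Ψ σ) (Ψ t) t :=
    (intervalIntegral.integral_hasDerivAt_right hii hmeas hcont).const_add _
  have hev : (fun τ => f τ x) =ᶠ[𝓝 t] fun τ => f s₀ x + ∫ σ in s₀..τ, Ψ σ := by
    filter_upwards [hIn] with τ hτ using hrep τ hτ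
  rw [← hΨ t]
  exact hprim.congr_of_eventuallyEq hev

end Equation

end

end Summit.NavierStokesRegularity.NavierStokesRegularity.Theorems.SwirlFreeBudget
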